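import Mathlib

/-!
# McKay-type parity certificates for equivariant anchors of rank ≤ 3

Solo-blind residency `solo-HodgeConjecture-blind`, K3-similarity face (door H), s20,
`paper/k3-weil-faces.md` §2.10.6 (Proposition D).

Setting (informal, proved in the paper; only the finite arithmetic is certified here).
Let `B` be a complex 2-torus, `h : A → B^∨` an isogeny of degree `d = 2`, `G = B[2]`, `G' = A[2]`,
and let `V` be a `G × G'`-equivariant holomorphic vector bundle of rank `r` on `B × A`.  At a pair of
2-torsion points `(p_i, p'_j)` the two commuting involutions `(-1_B, 1)` and `(1, -1_A)` act on the fibre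
`V(p_i, p'_j)` with simultaneous eigen-multiplicities `a = n₊₊, b = n₊₋, c = n₋₊, d = n₋₋` (`a+b+c+d = r`).
Write `τ = a+b-c-d`, `τ' = a-b+c-d` (traces of the two involutions) and `T = a-b-c+d` (trace of the
product).  For the sheaf `F = Φ(V)` on `Km B × Km A` obtained by the Kummer construction, the node block of
`c₂(End F)` is `Δ_ij = 2(bc - ad) = (τ τ' - r T)/2` (`trace_identity` below), and the traces `τ`, `τ'`
are constant along slices (rigidity of the involution action on a connected fixed component).
An exact anchor requires `Δ Δᵗ = 4 d C² · 1₁₆ = 8 C² · 1₁₆` with `C ∈ ℤ`, `C ≠ 0`.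

* rank 2 (`rank_two_table`, `rank_two_onesided`): slice-constancy forces either `Δ ≡ 0` or every entry
  `Δ_ij = ±2`; then a row of `Δ Δᵗ` gives `16 · 4 = 64 = 8 C²`, i.e. `C² = 8`, impossible
  (`no_int_sq_eq_eight`).
* rank 3 (`rank_three_table_pp`, `rank_three_table_pm`, `rank_three_onesided`): either `Δ ≡ 0` or every
  entry is `±2` or `±4`; a row with `β` entries of modulus 4 gives `64 + 12 β = 8 C²`, impossible mod 3
  (`no_row_identity_rank_three`).

Hence no `G × G'`-equivariant vector bundle of rank ≤ 3 on `B × A` yields an exact anchor for the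
multiplier-2 similarity; this extends the split/induced no-go of §2.7.4 to all equivariant bundles of
rank ≤ 3.  (Rank 4 reduces to signed 2-regular or `W(16,8)` weighing patterns and stays open.)
-/

namespace Summit.HodgeConjecture.HodgeConjecture.Theorems

/-- `τ τ' - r T = 4 (b c - a d)`: the node entry `Δ = 2(bc-ad)` equals `(τ τ' - r T)/2`. -/
theorem mcKay_trace_identity (a b c d : ℤ) :
    (a + b - c - d) * (a - b + c - d) - (a + b + c + d) * (a - b - c + d) = 4 * (b * c - a * d) := by
  ring

/-- Rank 2, balanced traces `τ = τ' = 0`: the node entry `Δ = 2(bc - ad)` is `±2`, never `0`. -/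
theorem mcKay_rank_two_table :
    ∀ a b c d : Fin 3, (a : ℕ) + b + c + d = 2 → (a : ℕ) + b = c + d → (a : ℕ) + c = b + d →
      (2 * ((b : ℕ) * c) = 2 * (a * d) + 2 ∨ 2 * ((a : ℕ) * d) = 2 * (b * c) + 2) := by
  decide

/-- Rank 2 (or any rank), one-sided trace (`c = d = 0`, i.e. `τ = r`): the node entry vanishes. -/
theorem mcKay_onesided (a b c d : ℕ) (hc : c = 0) (hd : d = 0) : 2 * (b * c) = 2 * (a * d) := by
  subst hc; subst hd; simp

/-- Rank 3, traces `τ = τ' = 1`: `Δ = 2(bc - ad) ∈ {2, -4}`. -/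
theorem mcKay_rank_three_table_pp :
    ∀ a b c d : Fin 4, (a : ℕ) + b + c + d = 3 → (a : ℕ) + b = c + d + 1 → (a : ℕ) + c = b + d + 1 →
      (2 * ((b : ℕ) * c) = 2 * (a * d) + 2 ∨ 2 * ((a : ℕ) * d) = 2 * (b * c) + 4) := by
  decide

/-- Rank 3, traces `τ = 1`, `τ' = -1`: `Δ = 2(bc - ad) ∈ {-2, 4}`. -/
theorem mcKay_rank_three_table_pm :
    ∀ a b c d : Fin 4, (a : ℕ) + b + c + d = 3 → (a : ℕ) + b = c + d + 1 → (b : ℕ) + d = a + c + 1 →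
      (2 * ((a : ℕ) * d) = 2 * (b * c) + 2 ∨ 2 * ((b : ℕ) * c) = 2 * (a * d) + 4) := by
  decide

/-- `C² = 8` has no integer solution (rank-2 row identity `64 = 8 C²`). -/
theorem mcKay_no_int_sq_eq_eight : ¬ ∃ C : ℤ, C ^ 2 = 8 := by
  rintro ⟨C, hC⟩
  have key : ∀ z : ZMod 16, z ^ 2 ≠ 8 := by decide
  apply key (C : ZMod 16)
  have h := congrArg (Int.cast : ℤ → ZMod 16) hC
  push_cast at h
  exact h

/-- Rank-2 row identity: sixteen entries of modulus 2 cannot have squared norm `8 C²`. -/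
theorem mcKay_no_row_identity_rank_two : ¬ ∃ C : ℤ, 8 * C ^ 2 = 16 * 4 := by
  rintro ⟨C, hC⟩
  exact mcKay_no_int_sq_eq_eight ⟨C, by linarith⟩

/-- Rank-3 row identity: `64 + 12 β = 8 C²` (β = number of entries of modulus 4 in a row) has no
integer solution, by reduction mod 3. -/
theorem mcKay_no_row_identity_rank_three : ¬ ∃ C β : ℤ, 8 * C ^ 2 = 64 + 12 * β := by
  rintro ⟨C, β, h⟩
  have key : ∀ z w : ZMod 3, 8 * z ^ 2 ≠ 64 + 12 * w := by decide
  apply key (C : ZMod 3) (β : ZMod 3)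
  have h' := congrArg (Int.cast : ℤ → ZMod 3) h
  push_cast at h'
  exact h'

end Summit.HodgeConjecture.HodgeConjecture.Theorems
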